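import Literature.Probability.Percolation.QuadCrossingSpace
import HarnessLib

/-!
# Crossing events are stable under small perturbations of quads (Schramm–Smirnov 2011, Lemma 6.1)

Topic `Probability/Percolation`, companion of `QuadCrossingSpace.lean` (the Schramm–Smirnov space
`ℋ_D = QuadConfig D`, quads `𝒬_D = Quad D` with sides `∂ₖQ = Quad.side Q k`, the crossing events
`⊞_Q = QuadConfig.crossedEvent Q`, and the laws `μ_δ = squareCrossingLaw D δ` of critical bond
percolation on `δℤ²`) and of `QuadCrossingContinuityEvents.lean` (Lemma 5.1, whose printed proof
rests on the lemma vendored here).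

**Source (held, read at the page: arXiv:1101.5820 = Ann. Probab. 39 (2011), §6 "Continuity of
crossing events", first lemma; our text chunk p0022 L8–54).** O. Schramm, S. Smirnov, *On the
scaling limits of planar percolation*:

> **Lemma 6.1.** There exist a positive function `Δ_c(δ, d)`, such that
> `lim_{δ → 0} Δ_c(δ, d) = 0` for any fixed `d`, and the following estimates hold. Let `Q` be a
> quad. Let `d_j`, `j = 0, 1`, be the infimum diameter of any path in `[Q]` connecting `∂_j Q` and
> `∂_{j+2} Q`, and define `d := max{d_0, d_1}`. Fix some `δ < d/2`. Let `Q'` be another quad,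
> satisfying at least one of the following conditions:
> (1) `[Q'] = [Q]`, `∂₀Q' = ∂₀Q`, `∂₁Q' = ∂₁Q`, and there is a path `γ ⊂ [Q]` of diameter at
> most `δ` that separates `{Q(1,1), Q'(1,1)}` from `∂₀Q ∪ ∂₁Q` inside `[Q]`;
> (2) `[Q'] ⊂ [Q]`, `∂₀Q' = ∂₀Q`, `∂₁Q' ⊂ ∂₁Q`, `∂₃Q' ⊂ ∂₃Q`, and each point on `∂₂Q'` can be
> connected to `∂₂Q` by a path `α ⊂ [Q]` with `diam(α) ≤ δ`;
> (3) `[Q'] ⊂ [Q]`, `∂₀Q' ⊂ ∂₀Q`, `∂₁Q' = ∂₁Q`, `∂₂Q' ⊂ ∂₂Q`, and each point on `∂₃Q'` can be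
> connected to `∂₃Q` by a path `α ⊂ [Q]` with `diam(α) ≤ δ`.
> Then for every `|η| < δ` we have `P_η(⊞_Q Δ ⊞_{Q'}) < Δ_c(δ, d)`.

("The proof below is a simple application of the RSW estimate (1.1) and the 'lowest crossing'
concept"; scope, §1.2 p. 7: "we study collections of percolation models satisfying
Assumptions 1.1. In particular, our results apply to critical and near-critical site percolation
on the triangular lattice and bond percolation on the square lattice".)

## Content

* `Quad.sideDist Q j` — `d_j(Q)`, the infimum of the diameters of paths in `[Q]` joining `∂_jQ`
  to `∂_{j+2}Q`; `Quad.sizeParam Q = max (d₀ Q) (d₁ Q)` — the `d` of the lemma;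
* `Quad.ShortJoin Q δ x T` — "`x` can be connected to `T` by a path `α ⊂ [Q]` with `diam α ≤ δ`";
* `Quad.IsPerturbationOne/Two/Three Q Q' δ` — the three printed conditions, verbatim;
* `SchrammSmirnov2011_lemma_6_1` — the lemma for the instance the tree carries, CRITICAL BOND
  PERCOLATION ON `δℤ²` (`squareCrossingLaw`), as a named fact (D-0014; statement only).

## Faithfulness notes

* INSTANCE, NOT THE GENERAL STATEMENT. The printed lemma is uniform over a collection of
  percolation models `η` (mesh `|η|`) satisfying the RSW Assumption 1.1 (1); the tree has the
  quad-crossing laws of one such model, bond percolation on `ℤ²` at `p = 1/2`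
  (`squareCrossingLaw D η`, mesh `η > 0`), which the source lists explicitly (p. 7). The vendored
  `Prop` is the lemma for that model — a consequence of the printed statement, same cite.
* `d = max{d₀, d₁}`: the binary operation is a TeX macro lost in our text extraction
  ("`d := \{d_0, d_1\}`"); `max` is forced by the case analysis of the printed proof (p0022
  L150–156: "(i) `d = d₁`, (ii) `d = d₀ > δ ≥ d₁`, (iii) `d = d₀ > d₁ > δ`" — case (ii) is
  inconsistent with `min`).
* "positive function … `lim_{δ→0} Δ_c(δ,d) = 0` for any fixed `d`": rendered for `δ, d > 0`
  (the only arguments at which the lemma is applied: `0 < |η| < δ < d/2`), limit along `𝓝[>] 0`.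
* "separates `{Q(1,1), Q'(1,1)}` from `∂₀Q ∪ ∂₁Q` inside `[Q]`" (condition (1)) is rendered
  path-wise: every path in `[Q]` from either corner to `∂₀Q ∪ ∂₁Q` meets `γ`.
* `⊞_Q Δ ⊞_{Q'}` is Mathlib's `symmDiff` of the two crossing events in `ℋ_D`; `P_η` of it is the
  `Measure.real` mass under `squareCrossingLaw D η` (the push-forward of `P_{1/2}` by
  `configOf`, `QuadCrossingSpace.lean`), for quads of an arbitrary `D ⊆ ℂ` as in `ℋ_D`.
* Consumers: grounds the mechanism of items `OddShift` (stmt-CriticalPhenomena-8376) and the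
  sandwich step of `CoveringBridge` (stmt-CriticalPhenomena-4560) of routes
  `Summits/CriticalPhenomena/CardyFormulaZ2/Theses/{DWavePairKernel, UnionJackBeffara}` — crude
  crossing probabilities of a conformal rectangle are insensitive to `O(δ)` perturbations of the
  domain, uniformly in the mesh, by RSW alone.

## References

* O. Schramm, S. Smirnov, Ann. Probab. 39 (2011) 1768–1814, arXiv:1101.5820: Lemma 6.1 (§6),
  Assumptions 1.1 and §1.2 p. 7, §1.3 (quads, `⊞_Q`, `μ_η`). [SchrammSmirnov2011]
-/

noncomputable section

open Set Filter MeasureTheory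
open scoped Topology unitInterval

namespace Literature.Probability.Percolation

namespace QuadCrossing

namespace Quad

variable {D : Set ℂ}

/-- **`d_j(Q)`** (`j = 0, 1`; also defined for `j = 2, 3`, symmetrically): "the infimum diameter
of any path in `[Q]` connecting `∂_j Q` and `∂_{j+2} Q`" (`Metric.diam` of the range of a Mathlib
`Path` inside `Q.carrier`; the defining set is nonempty since `[Q]` is path connected).
[cite: SchrammSmirnov2011, Lemma 6.1] -/
def sideDist (Q : Quad D) (j : Fin 4) : ℝ :=
  sInf {r : ℝ | ∃ x ∈ Q.side j, ∃ y ∈ Q.side (j + 2), ∃ γ : Path x y,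
    range γ ⊆ Q.carrier ∧ Metric.diam (range γ) = r}

/-- **`d(Q) = max{d₀(Q), d₁(Q)}`**, the size parameter of Lemma 6.1 (module docstring,
"Faithfulness notes", for `max`). [cite: SchrammSmirnov2011, Lemma 6.1] -/
def sizeParam (Q : Quad D) : ℝ :=
  max (Q.sideDist 0) (Q.sideDist 1)

/-- "`x` can be connected to `T` by a path `α ⊂ [Q]` with `diam(α) ≤ δ`".
[cite: SchrammSmirnov2011, Lemma 6.1] -/
def ShortJoin (Q : Quad D) (δ : ℝ) (x : ℂ) (T : Set ℂ) : Prop :=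
  ∃ y ∈ T, ∃ α : Path x y, range α ⊆ Q.carrier ∧ Metric.diam (range α) ≤ δ

/-- **Condition (1) of Lemma 6.1**: "`[Q'] = [Q]`, `∂₀Q' = ∂₀Q`, `∂₁Q' = ∂₁Q`, and there is a path
`γ ⊂ [Q]` of diameter at most `δ` that separates `{Q(1,1), Q'(1,1)}` from `∂₀Q ∪ ∂₁Q` inside
`[Q]`" (every path in `[Q]` from either corner to `∂₀Q ∪ ∂₁Q` meets `γ`).
[cite: SchrammSmirnov2011, Lemma 6.1 (1)] -/
def IsPerturbationOne (Q Q' : Quad D) (δ : ℝ) : Prop :=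
  Q'.carrier = Q.carrier ∧ Q'.side 0 = Q.side 0 ∧ Q'.side 1 = Q.side 1 ∧
    ∃ (a b : ℂ) (γ : Path a b), range γ ⊆ Q.carrier ∧ Metric.diam (range γ) ≤ δ ∧
      ∀ p ∈ ({Q (1, 1), Q' (1, 1)} : Set ℂ), ∀ y ∈ Q.side 0 ∪ Q.side 1, ∀ β : Path p y,
        range β ⊆ Q.carrier → (range β ∩ range γ).Nonempty

/-- **Condition (2) of Lemma 6.1**: "`[Q'] ⊂ [Q]`, `∂₀Q' = ∂₀Q`, `∂₁Q' ⊂ ∂₁Q`, `∂₃Q' ⊂ ∂₃Q`, and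
each point on `∂₂Q'` can be connected to `∂₂Q` by a path `α ⊂ [Q]` with `diam(α) ≤ δ`".
[cite: SchrammSmirnov2011, Lemma 6.1 (2)] -/
def IsPerturbationTwo (Q Q' : Quad D) (δ : ℝ) : Prop :=
  Q'.carrier ⊆ Q.carrier ∧ Q'.side 0 = Q.side 0 ∧ Q'.side 1 ⊆ Q.side 1 ∧ Q'.side 3 ⊆ Q.side 3 ∧
    ∀ x ∈ Q'.side 2, Q.ShortJoin δ x (Q.side 2)

/-- **Condition (3) of Lemma 6.1**: "`[Q'] ⊂ [Q]`, `∂₀Q' ⊂ ∂₀Q`, `∂₁Q' = ∂₁Q`, `∂₂Q' ⊂ ∂₂Q`, and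
each point on `∂₃Q'` can be connected to `∂₃Q` by a path `α ⊂ [Q]` with `diam(α) ≤ δ`".
[cite: SchrammSmirnov2011, Lemma 6.1 (3)] -/
def IsPerturbationThree (Q Q' : Quad D) (δ : ℝ) : Prop :=
  Q'.carrier ⊆ Q.carrier ∧ Q'.side 0 ⊆ Q.side 0 ∧ Q'.side 1 = Q.side 1 ∧ Q'.side 2 ⊆ Q.side 2 ∧
    ∀ x ∈ Q'.side 3, Q.ShortJoin δ x (Q.side 3)

end Quad

/-- **Schramm–Smirnov 2011, Lemma 6.1 (crossing events are stable under small perturbations of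
quads), for critical bond percolation on `δℤ²`.** Printed (for every percolation model `η` of
mesh `|η|` satisfying the RSW Assumption 1.1 (1), bond-`ℤ²` included, p. 7): "There exist a
positive function `Δ_c(δ, d)`, such that `lim_{δ→0} Δ_c(δ, d) = 0` for any fixed `d` … Let `Q`
be a quad. Let `d_j`, `j = 0, 1`, be the infimum diameter of any path in `[Q]` connecting `∂_jQ`
and `∂_{j+2}Q`, and define `d := max{d₀, d₁}`. Fix some `δ < d/2`. Let `Q'` be another quad,
satisfying at least one of the conditions (1), (2), (3) [`Quad.IsPerturbationOne/Two/Three`].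
Then for every `|η| < δ` we have `P_η(⊞_Q Δ ⊞_{Q'}) < Δ_c(δ, d)`." Tree rendering: one function
`Δc`, positive and tending to `0` as `δ → 0⁺` for each fixed `d > 0`, bounds
`μ_η(⊞_Q Δ ⊞_{Q'})` (`squareCrossingLaw D η`, `QuadConfig.crossedEvent`, Mathlib `symmDiff`,
`Measure.real`) for all `D ⊆ ℂ`, all quads `Q, Q'` of `D`, all `0 < δ < d(Q)/2` with one of the
three conditions, and all meshes `0 < η < δ`. Named fact (D-0014), statement only; the printed
proof uses only RSW and the lowest crossing. Grounds `Summit.CriticalPhenomena.CardyFormulaZ2.Theses.DWavePairKernel.OddShift`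
(mechanism) and the sandwich step of `….CoveringBridge`.

**Status (librarian fact-decompose verdict, review item wi-30739, 2026-08-16 — MISSTATED AS A PROVE
TARGET; do not take this `def` as a hypothesis and do not re-seat it for proof).**  The rendering is
faithful to the printed words but (i) *weaker than its only printed use*: the envelope "`Δ_c(δ, d) → 0`
for each fixed `d`" carries no uniformity/monotonicity in `d`, whereas Schramm–Smirnov's derivation of
(5.1)/Lemma 5.1 silently uses the scale-free form `μ_η(⊞_Q Δ ⊞_{Q'}) ≤ F(δ/d(Q))` (documented in
`QuadCrossingContinuityOfBound.lean`, which derives (5.1) and Lemma 5.1 from a scale-free bound: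
`SchrammSmirnov2011_lemma_5_1_of_bound`, `continuity_of_uniform`); and (ii) *more general than the
printed proof*: it quantifies over ALL topological quads of every `D`, while the printed decoupling step
("the restriction of `ω` to `[Q] ∖ M` is unbiased", lowest crossing) fails for quads whose carrier meets
a lattice edge segment in a disconnected set (sub-mesh exterior pockets) — Schramm–Smirnov only apply the
lemma to Riemann-map-regularised quads (proof of Lemma 5.1; cf. `QuadCrossingGeneralPosition.lean`).
What IS a theorem of the tree, in this very format: `SchrammSmirnov2011_lemma_6_1_tame`
(`QuadCrossingContinuityTame.lean`; condition (1) for all quads, conditions (2), (3) on lattice-tame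
pairs, from `real_symmDiff_crossedEvent_le_of_isPerturbationOne/…Two_of_tame3_all/…Three_of_tame_all`).
Use those.  No Lean declaration consumes the present `def` as a hypothesis.
[cite: SchrammSmirnov2011, Lemma 6.1] -/
def SchrammSmirnov2011_lemma_6_1 : Prop :=
  ∃ Δc : ℝ → ℝ → ℝ,
    (∀ δ d : ℝ, 0 < δ → 0 < d → 0 < Δc δ d) ∧
    (∀ d : ℝ, 0 < d → Tendsto (fun δ => Δc δ d) (𝓝[>] 0) (𝓝 0)) ∧
    ∀ (D : Set ℂ) (Q Q' : Quad D) (δ : ℝ), 0 < δ → δ < Q.sizeParam / 2 →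
      (Q.IsPerturbationOne Q' δ ∨ Q.IsPerturbationTwo Q' δ ∨ Q.IsPerturbationThree Q' δ) →
        ∀ η : ℝ, 0 < η → η < δ →
          (squareCrossingLaw D η : Measure (QuadConfig D)).real
              (symmDiff (QuadConfig.crossedEvent Q) (QuadConfig.crossedEvent Q')) <
            Δc δ Q.sizeParam

/-- Unfolding/usage form of `SchrammSmirnov2011_lemma_6_1` for condition (2) (the case used to
compare a quad with an inner perturbation of itself). [cite: SchrammSmirnov2011, Lemma 6.1 (2)] -/
theorem SchrammSmirnov2011_lemma_6_1.of_isPerturbationTwo (h : SchrammSmirnov2011_lemma_6_1) :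
    ∃ Δc : ℝ → ℝ → ℝ,
      (∀ d : ℝ, 0 < d → Tendsto (fun δ => Δc δ d) (𝓝[>] 0) (𝓝 0)) ∧
      ∀ (D : Set ℂ) (Q Q' : Quad D) (δ : ℝ), 0 < δ → δ < Q.sizeParam / 2 →
        Q.IsPerturbationTwo Q' δ → ∀ η : ℝ, 0 < η → η < δ →
          (squareCrossingLaw D η : Measure (QuadConfig D)).real
              (symmDiff (QuadConfig.crossedEvent Q) (QuadConfig.crossedEvent Q')) <
            Δc δ Q.sizeParam := by
  obtain ⟨Δc, -, hlim, hest⟩ := h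
  exact ⟨Δc, hlim, fun D Q Q' δ hδ hδd h2 η hη hηδ => hest D Q Q' δ hδ hδd (Or.inr (Or.inl h2)) η hη hηδ⟩

end QuadCrossing

end Literature.Probability.Percolation

end
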